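import Summits.BirchSwinnertonDyer.Rank1Residual.Additive.DisegniLineTwistData
import Summits.BirchSwinnertonDyer.Rank1Residual.Additive.DisegniLineTwistDataOdd
import Summits.BirchSwinnertonDyer.Rank1Residual.Additive.GordTwistMinimalModel
import Summits.BirchSwinnertonDyer.Rank1Residual.AdditivePotMult.PStarTwistModel
import HarnessLib

/-!
# Route `AdditiveBranchIMC` (rung K1), crux `MultLower` (item 19359), cell (M): the KERNEL (M) twin of
# gz's STEP C(3b) — the twist data attached to a Heegner field for a MULTIPLICATIVE twist model

Cell `bsd-addord`, seat `bsd-addord-k1-c4` (gen 4). THEOREMS ONLY (no definition, no named fact, no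
`sorry`). gz's `DisegniLineTwistData[Odd]` (`exists_twist_newform[_neg]`) produces, for `E = W ≅ V ⊗ χ_{p*}`
with `V` GOOD ORDINARY at `p` and a Heegner field `K` for `N_E`, the good ordinary twist `V′ ≅ V ⊗ κ_K` with
`a_p(V′) = a_p(V)`; the (G-ord) proof uses `N_E = N_V·p²` (`conductorNorm_eq_of_good_twist`, false on
(M)) only to transfer the Heegner hypothesis from `N_E` to `N_V`. On (M) (`V` MULTIPLICATIVE at `p`,
`N_E = N_V·p`) we transfer it prime by prime instead:

* `dvd_conductorNorm_of_dvd_conductorNorm_twist_model`: for `C • V^{(p*)} = W` with `W` additive at `p`,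
  every prime of `N_V` divides `N_W` (at `q ≠ p` the conductor exponents agree,
  `conductorExponent_eq_of_twist_pStar_of_ne` + `factorization_conductorNorm_holds`; `p ∣ N_W`);
  `satisfiesHeegnerHypothesis_of_twist_model`: Heegner for `N_W` ⟹ Heegner for `N_V`.
* `exists_twist_newform_mult` (BOTH parities, `p* = (−1)^{(p−1)/2}p`): `p ∤ d_K`,
  `a_n(E^{(d_K)}) = κ(n)a_n(E)`, and a globally minimal `V′ ≅ V ⊗ κ_K`, MULTIPLICATIVE at `p`
  (`mult_quadraticTwist_of_padicValRat_eq_zero`: `p ∤ d_K`), with newform `f′`,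
  `a_n(f′) = κ(n)a_n(f)` and `a_p(V′) = a_p(V)` (`κ(p) = (d_K/p) = 1`: `p ∣ N_E` splits in `K`).

gz's `legendrePlusSymbolSum_ne_zero_of_twist` / `legendreMinusSymbolSum_ne_zero_of_twist`
(`∑(a/p)[a/p]^±_{f′} ≠ 0 ⟸ L(E^{(d_K)},1) ≠ 0`) are reduction-free and are used as they stand.

References: [SilvermanAEC2009] VII.5 Prop. 5.1(b), X.2 Prop. 2.4; [GrossZagier1986] §I.1 (Heegner
hypothesis); [Cox2013] §1.C Lemma 1.14; gz's `DisegniLineTwistData.lean` (p413742).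
-/

set_option autoImplicit false
set_option linter.dupNamespace false

noncomputable section

open scoped Classical MatrixGroups ModularForm NumberField

namespace Summit.BirchSwinnertonDyer.BirchSwinnertonDyer.Theorems.AdditiveBranchIMCMultLower

open CongruenceSubgroup WeierstrassCurve NumberField IsDedekindDomain Rat.HeightOneSpectrum
  Literature.NumberTheory.EllipticCurves Literature.NumberTheory.EllipticCurves.ModularForms
  Literature.NumberTheory.EllipticCurves.Rank1Residual Literature.NumberTheory.QuadraticFields
  Literature.NumberTheory.QuadraticFields.Quadratic
  Summit.BirchSwinnertonDyer.Rank1Residual.Additive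
  Summit.BirchSwinnertonDyer.Rank1Residual.AdditivePotMult

section Conductor

variable {p : ℕ} [hp : Fact p.Prime]

/-- **Every prime of `N_V` divides `N_W`** for a twist model `C • V^{(p*)} = W` with `W` additive at the
odd prime `p`: at `q ≠ p` the conductor exponents of `V` and `W` agree (the twist by `p*` is unramified
there), and `p ∣ N_W`. [cite: SilvermanAEC2009, VII.5 Prop. 5.1 and X.2 Prop. 2.4]
[cite: SilvermanATAEC1994, IV.9.4 (PDF pp. 344–346)] -/
theorem dvd_conductorNorm_of_dvd_conductorNorm_twist_model (hp2 : p ≠ 2) (V W : WeierstrassCurve ℚ)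
    [V.IsElliptic] [W.IsElliptic] (C : VariableChange ℚ)
    (hC : C • V.quadraticTwist ((-1 : ℚ) ^ (p / 2) * p) = W) (hW : Addv W p)
    {q : ℕ} (hq : q.Prime) (hqV : q ∣ V.conductorNorm ℤ) : q ∣ W.conductorNorm ℤ := by
  by_cases hqp : q = p
  · subst hqp
    exact (W.dvd_conductorNorm_iff_not_hasGoodReductionAtPrime q).mpr hW.1
  · haveI : Fact q.Prime := ⟨hq⟩
    have hgen : natGenerator (placeOf q) = q := natGenerator_placeOf_eq q
    have hW' := W.factorization_conductorNorm_holds (placeOf q)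
    have hV' := V.factorization_conductorNorm_holds (placeOf q)
    rw [hgen] at hW' hV'
    have heq : W.conductorExponent (placeOf q) = V.conductorExponent (placeOf q) :=
      conductorExponent_eq_of_twist_pStar_of_ne p hp2 V W C hC (placeOf q) (by rw [hgen]; exact hqp)
    have hV0 : V.conductorNorm ℤ ≠ 0 := (V.conductorNorm_pos_holds).ne'
    have h1 : 0 < (V.conductorNorm ℤ).factorization q := hq.factorization_pos_of_dvd hV0 hqV
    rw [hV', ← heq, ← hW'] at h1
    exact Nat.dvd_of_factorization_pos h1.ne'

/-- **The Heegner hypothesis descends from `N_W` to `N_V`** along a twist model `C • V^{(p*)} = W`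
(`W` additive at the odd `p`). [cite: GrossZagier1986, §I.1 (Heegner hypothesis)] -/
theorem satisfiesHeegnerHypothesis_of_twist_model (hp2 : p ≠ 2) (K : Type) [Field K]
    (V W : WeierstrassCurve ℚ) [V.IsElliptic] [W.IsElliptic] (C : VariableChange ℚ)
    (hC : C • V.quadraticTwist ((-1 : ℚ) ^ (p / 2) * p) = W) (hW : Addv W p)
    (hH : SatisfiesHeegnerHypothesis (W.conductorNorm ℤ) K) :
    SatisfiesHeegnerHypothesis (V.conductorNorm ℤ) K :=
  fun q hq hqV ↦ hH q hq (dvd_conductorNorm_of_dvd_conductorNorm_twist_model hp2 V W C hC hW hq hqV)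

end Conductor

section Twist

variable {W : WeierstrassCurve ℚ} [W.IsElliptic] [W.IsGloballyMinimal] {p : ℕ} [hp : Fact p.Prime]
  (K : Type) [Field K] [NumberField K]

omit [W.IsGloballyMinimal] in
/-- **The twist data attached to a Heegner field, MULTIPLICATIVE twist model, both parities.** `E = W`
additive at the odd prime `p`, `C • V^{(p*)} = W` with `V` MULTIPLICATIVE at `p` (newform `f`), `K`
quadratic with the Heegner hypothesis for `N_E`, `κ` its Kronecker character carrying the twist
coefficients (gz's `exists_kroneckerChar_twistCoeff`). Then `p ∤ d_K`, `a_n(E^{(d_K)}) = κ(n)·a_n(E)`, and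
there is a globally minimal `V′ ≅ V ⊗ κ`, MULTIPLICATIVE at `p`, with newform `f′`,
`a_n(f′) = κ(n)·a_n(f)` and `a_p(V′) = a_p(V)` (`κ(p) = (d_K/p) = 1` since `p ∣ N_E` splits in `K`). The
(M) twin of gz's `exists_twist_newform`. [cite: SilvermanAEC2009, VII.5 Prop. 5.1(b), X.2 Prop. 2.4 and Exercise 10.16]
[cite: Knapp1993, Prop. 12.10] [cite: Cox2013, §1.C Lemma 1.14] -/
theorem exists_twist_newform_mult (hmodD : nonempty_modularParametrizationData) (hp2 : p ≠ 2)
    (h2 : Module.finrank ℚ K = 2) (κ : DirichletCharacter ℂ (NumberField.discr K).natAbs)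
    (hκ : ∀ ℓ : ℕ, ℓ.Prime → ℓ ≠ 2 → κ ℓ = (jacobiSym (NumberField.discr K) ℓ : ℂ))
    (hκall : ∀ (X : WeierstrassCurve ℚ) [X.IsElliptic],
      (∀ v : HeightOneSpectrum (𝓞 ℚ), ((primesEquiv v : ℕ) : ℤ) ∣ NumberField.discr K →
        X.HasGoodReductionAt v) →
      ∀ n : ℕ, (((X.quadraticTwist (NumberField.discr K : ℚ)).LFunction n : ℤ) : ℂ) =
        κ n * ((X.LFunction n : ℤ) : ℂ))
    (hH : SatisfiesHeegnerHypothesis (W.conductorNorm ℤ) K) (hadd : Addv W p)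
    (V : WeierstrassCurve ℚ) [V.IsElliptic] [V.IsGloballyMinimal] (C : VariableChange ℚ)
    (hC : C • V.quadraticTwist ((-1 : ℚ) ^ (p / 2) * p) = W) (hV : Mult V p)
    {N : ℕ} [NeZero N] {f : CuspForm (Gamma0 N) 2} (hf : IsNewformOf V f) :
    ¬ (p : ℤ) ∣ NumberField.discr K ∧
    (∀ n : ℕ, (((W.quadraticTwist (NumberField.discr K : ℚ)).LFunction n : ℤ) : ℂ) =
      κ n * ((W.LFunction n : ℤ) : ℂ)) ∧
    ∃ (V' : WeierstrassCurve ℚ) (_ : V'.IsElliptic) (_ : V'.IsGloballyMinimal) (N' : ℕ) (_ : NeZero N')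
      (f' : CuspForm (Gamma0 N') 2), IsNewformOf V' f' ∧
      (∀ n : ℕ, cuspCoeff f' n = κ (n : ZMod (NumberField.discr K).natAbs) * cuspCoeff f n) ∧
      V'.LFunction p = V.LFunction p ∧ Mult V' p := by
  have hpP : p.Prime := hp.out
  have hd0 : NumberField.discr K ≠ 0 := NumberField.discr_ne_zero K
  have hdq : (NumberField.discr K : ℚ) ≠ 0 := by exact_mod_cast hd0
  -- `p` splits in `K`
  have hpN : p ∣ W.conductorNorm ℤ :=
    (W.dvd_conductorNorm_iff_not_hasGoodReductionAtPrime p).mpr hadd.1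
  obtain ⟨hjp, hpd⟩ := jacobiSym_eq_one_of_heegner K h2 hH hpP hp2 hpN
  have hκp : κ (p : ZMod (NumberField.discr K).natAbs) = 1 := by rw [hκ p hpP hp2, hjp, Int.cast_one]
  -- Heegner for `N_V` (prime by prime) and good reduction at the primes of `d_K`
  have hHV : SatisfiesHeegnerHypothesis (V.conductorNorm ℤ) K :=
    satisfiesHeegnerHypothesis_of_twist_model hp2 K V W C hC hadd hH
  have hgoodV := hasGoodReductionAt_of_heegner_of_dvd_discr K h2 V hHV
  have hgoodW := hasGoodReductionAt_of_heegner_of_dvd_discr K h2 W hH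
  refine ⟨hpd, hκall W hgoodW, ?_⟩
  -- the minimal model of the twist and its newform
  obtain ⟨V', iE, iM, C', hC'⟩ := exists_isGloballyMinimal_smul_eq_quadraticTwist V hdq
  haveI : NeZero (V'.conductorNorm ℤ) := ⟨(V'.conductorNorm_pos_holds).ne'⟩
  obtain ⟨Dm'⟩ := hmodD V'
  have hLV' : ∀ n : ℕ, V'.LFunction n = (V.quadraticTwist (NumberField.discr K : ℚ)).LFunction n :=
    fun n ↦ by rw [← hC', LFunction_smul]
  have hV' : ∀ n : ℕ, cuspCoeff Dm'.f n = κ (n : ZMod (NumberField.discr K).natAbs) * cuspCoeff f n :=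
      fun n ↦ by
    rw [Dm'.isNewformOf.2 n, hf.2 n, hLV' n]
    exact hκall V hgoodV n
  -- `V'` is multiplicative at `p` (`p ∤ d_K`)
  have hval : padicValRat p (NumberField.discr K : ℚ) = 0 := by
    rw [padicValRat.of_int, padicValInt.eq_zero_of_not_dvd hpd, Nat.cast_zero]
  have hmultV' : Mult V' p :=
    mult_of_model_twist hdq (mult_quadraticTwist_of_padicValRat_eq_zero hp2 hdq hval hV)
      ⟨C'⁻¹, by rw [← hC', inv_smul_smul]⟩
  -- `a_p(V′) = a_p(V)`
  have hap : V'.LFunction p = V.LFunction p := by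
    have e : ((V'.LFunction p : ℤ) : ℂ) = ((V.LFunction p : ℤ) : ℂ) := by
      rw [hLV' p, hκall V hgoodV p, hκp, one_mul]
    exact_mod_cast e
  exact ⟨V', iE, iM, V'.conductorNorm ℤ, inferInstance, Dm'.f, Dm'.isNewformOf, hV', hap, hmultV'⟩

end Twist

end Summit.BirchSwinnertonDyer.BirchSwinnertonDyer.Theorems.AdditiveBranchIMCMultLower

end
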